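import Summits.RiemannHypothesis.RiemannHypothesis.Theses.LiDirichletAsymptotic
import Summits.RiemannHypothesis.RiemannHypothesis.Theorems.LiAsymptoticBoxTwoSidedPair
import Summits.RiemannHypothesis.RiemannHypothesis.Theorems.LiCoefficientsLiBoxSplitPair
import Literature.NumberTheory.LFunctions.WeilCriterionConverseDirichlet
import HarnessLib

/-!
# RiemannHypothesis / LiDirichletAsymptotic — crux K1χ `LiBoxTwoSidedChar`: the TWO-SIDED BOX COMPARISON (RH-FREE · GRH-FREE)

RH-FREE · GRH-FREE PROOF-OF-DATA (rung L-P(P1⁺χ)) [rh-li-prover].  Route `Theses/LiDirichletAsymptotic.lean`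
(cell `pub/rh-li`, round 5 (iii)), item `LiBoxTwoSidedChar` (stmt-RiemannHypothesis-19629): for a primitive `χ`
mod `q > 1`, GRH(χ) verified to height `T ≥ 4` (`LFunctionRHUpTo χ T`), `T ≤ T'` and `n ≤ T²/4`,

  `|charLiPartialRe χ n T' − charWeightTrace χ n T'| ≤ 2.82 n² Σ_{T<|γ|≤T'} m/|γ|⁴ + (n/2) Σ_{T<|γ|≤T'} m/|γ|³`.

Proof (χ-TRANSFER of the closed ζ item 19163 `LiBoxTwoSided`): below `T` every zero is on the line and its term
`Re[1 − (1 − 1/ρ)ⁿ]` IS `liWindowWeight₀ n |Im ρ|` (tree `BoxSplit.re_one_sub_pow_onLine`, plus the central value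
`1 − (−1)ⁿ` at `ρ = ½`); above `T` the reflection `ρ ↦ 1 − ρ̄` is a multiplicity-preserving involution of the zero
box (MV Cor. 10.8, tree `WeilConverseChar.zeroOrder_one_sub_conj`), so the sum equals HALF the sum of the PAIR terms
`Re[1 − wⁿ] + Re[1 − w'ⁿ] − 2 f_n(|γ|)`, each bounded by the q-free pair lemma of the ζ twin
(`BoxSplit.pair_two_sided`, lower half-plane by conjugation) — the typed bound with a factor `2` to spare.
Nothing here bears on the truth of RH or GRH: the only zero input is the FINITE verified height.
-/

noncomputable section

-- D-0017: `Summit.<S>.<S>.…` is the designed namespace of a single-problem summit.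
set_option linter.dupNamespace false

open Complex Set
open scoped Real ComplexConjugate

namespace Summit.RiemannHypothesis.RiemannHypothesis.Theorems.LiTheory

open Literature.NumberTheory.LFunctions Literature.NumberTheory.LFunctions.ExplicitPsiChar
open Literature.NumberTheory.LFunctions.DirichletDisc (zeroOrder)

namespace BoxChar

variable {q : ℕ} [NeZero q] {χ : DirichletCharacter ℂ q}

/-- The Li term is conjugation invariant: `Re[1 − (1 − 1/ρ̄)ⁿ] = Re[1 − (1 − 1/ρ)ⁿ]`. -/
theorem re_liTerm_conj (n : ℕ) (ρ : ℂ) : (1 - (1 - 1 / conj ρ) ^ n).re = (1 - (1 - 1 / ρ) ^ n).re := by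
  have h : (1 : ℂ) - (1 - 1 / conj ρ) ^ n = conj (1 - (1 - 1 / ρ) ^ n) := by
    simp [map_sub, map_pow]
  rw [h, Complex.conj_re]

/-- ON-LINE EXACTNESS including the centre: for `Re ρ = ½`, `Re[1 − (1 − 1/ρ)ⁿ] = liWindowWeight₀ n |Im ρ|`
(`BoxSplit.re_one_sub_pow_onLine` off the real axis, `f_n` even; `1 − 1/ρ = −1` at `ρ = ½`). -/
theorem re_liTerm_onLine (n : ℕ) {ρ : ℂ} (hre : ρ.re = 1 / 2) :
    (1 - (1 - 1 / ρ) ^ n).re = liWindowWeight₀ n |ρ.im| := by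
  by_cases him : ρ.im = 0
  · have hρ : ρ = ((1 / 2 : ℝ) : ℂ) := Complex.ext (by simp [hre]) (by simp [him])
    rw [liWindowWeight₀, if_pos (by rw [him, abs_zero]), hρ]
    have e : (1 : ℂ) - 1 / ((1 / 2 : ℝ) : ℂ) = ((-1 : ℝ) : ℂ) := by
      push_cast; norm_num
    rw [e, ← Complex.ofReal_pow, ← Complex.ofReal_one, ← Complex.ofReal_sub, Complex.ofReal_re]
  · rw [liWindowWeight₀, if_neg (by rwa [abs_eq_zero]), BoxSplit.re_one_sub_pow_onLine n hre him]
    rcases abs_choice ρ.im with h | h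
    · rw [h]
    · rw [h, BoxSplit.liWindowWeight_neg]

/-- The PAIR BOUND at either sign of the ordinate: for `0 < Re ρ < 1`, `|Im ρ| ≥ 4`, `n ≤ |Im ρ|²/4`,
`|Re[1 − (1 − 1/ρ)ⁿ] + Re[1 − (1 − 1/(1 − ρ̄))ⁿ] − 2 f_n(|Im ρ|)| ≤ 2.82 n²/|Im ρ|⁴ + n/(2|Im ρ|³)`
(the ζ twin's `BoxSplit.pair_two_sided`; the lower half-plane by conjugation). -/
theorem pair_two_sided_abs (n : ℕ) {ρ : ℂ} (h0 : 0 < ρ.re) (h1 : ρ.re < 1) (h4 : 4 ≤ |ρ.im|)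
    (hn : (n : ℝ) ≤ |ρ.im| ^ 2 / 4) :
    |((1 - (1 - 1 / ρ) ^ n).re + (1 - (1 - 1 / (1 - conj ρ)) ^ n).re - 2 * liWindowWeight n |ρ.im|)| ≤
      2.82 * (n : ℝ) ^ 2 / |ρ.im| ^ 4 + (n : ℝ) / (2 * |ρ.im| ^ 3) := by
  rcases le_or_gt 0 ρ.im with hpos | hneg
  · rw [abs_of_nonneg hpos] at h4 hn ⊢
    exact BoxSplit.pair_two_sided n h0.le h1.le h4 hn
  · -- apply the pair lemma to `ρ' = conj ρ` (`Im ρ' = |Im ρ|`) and transport by conjugation invariance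
    have him : |ρ.im| = (conj ρ).im := by rw [abs_of_neg hneg, Complex.conj_im]
    rw [him] at h4 hn ⊢
    have hp := BoxSplit.pair_two_sided n (ρ := conj ρ) (by simpa using h0.le) (by simpa using h1.le) h4 hn
    rw [re_liTerm_conj n ρ, Complex.conj_conj] at hp
    have e : (1 : ℂ) - ρ = conj (1 - conj ρ) := by simp
    rw [e, re_liTerm_conj n (1 - conj ρ)] at hp
    exact hp

/-- The reflection `ρ ↦ 1 − ρ̄` preserves the zero box of `L(s, χ)` (χ primitive, `q > 1`). -/
theorem one_sub_conj_mem_box (hχ : χ.IsPrimitive) (hq : 1 < q) {T : ℝ} {ρ : ℂ}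
    (hρ : ρ ∈ lfunctionZeroBox χ T) : 1 - conj ρ ∈ lfunctionZeroBox χ T := by
  have hχ1 : χ ≠ 1 := ne_one_of_isPrimitive hχ hq
  obtain ⟨hz, h0, h1, hT⟩ := mem_lfunctionZeroBox.1 hρ
  refine mem_lfunctionZeroBox.2 ⟨?_, ?_, ?_, ?_⟩
  · rw [← DirichletDisc.zeroOrder_pos_iff χ hχ1, WeilConverseChar.zeroOrder_one_sub_conj hχ hχ1 h0 h1,
      DirichletDisc.zeroOrder_pos_iff χ hχ1]
    exact hz
  · simp only [Complex.sub_re, Complex.one_re, Complex.conj_re]; linarith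
  · simp only [Complex.sub_re, Complex.one_re, Complex.conj_re]; linarith
  · simpa using hT

end BoxChar

open BoxChar in
/-- **Crux K1χ `LiBoxTwoSidedChar`** (stmt-RiemannHypothesis-19629; RH-FREE · GRH-FREE given the verified height):
for `χ` primitive mod `q > 1`, `LFunctionRHUpTo χ T`, `4 ≤ T`, `n ≤ T²/4` (any `T'`; the item adds `T ≤ T'`),
`|charLiPartialRe χ n T' − charWeightTrace χ n T'| ≤ 2.82 n² · charInvMomentTail χ 4 T T' + (n/2) · charInvMomentTail χ 3 T T'`
(in fact half of it). -/
theorem liBoxTwoSidedChar_bound (q : ℕ) [NeZero q] (χ : DirichletCharacter ℂ q) (hχ : χ.IsPrimitive)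
    (hq : 1 < q) (n : ℕ) (T T' : ℝ) (hRH : LFunctionRHUpTo χ T) (hT4 : 4 ≤ T)
    (hn : (n : ℝ) ≤ T ^ 2 / 4) :
    |charLiPartialRe χ n T' - charWeightTrace χ n T'| ≤
      2.82 * (n : ℝ) ^ 2 * charInvMomentTail χ 4 T T' + (n : ℝ) / 2 * charInvMomentTail χ 3 T T' := by
  classical
  have hχ1 : χ ≠ 1 := ne_one_of_isPrimitive hχ hq
  have hfin : (lfunctionZeroBox χ T').Finite := lfunctionZeroBox_finite hχ1 T'
  have hfinD : (lfunctionZeroBox χ T' \ lfunctionZeroBox χ T).Finite := hfin.subset fun _ hρ ↦ hρ.1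
  set S := hfin.toFinset with hS
  have hmemS : ∀ ρ, ρ ∈ S ↔ ρ ∈ lfunctionZeroBox χ T' := fun ρ ↦ Set.Finite.mem_toFinset _
  -- the three functions: Li term, multiplicity, defect against the weight
  set g : ℂ → ℝ := fun ρ ↦ (1 - (1 - 1 / ρ) ^ n).re with hg
  set m : ℂ → ℝ := fun ρ ↦ (zeroOrder χ ρ : ℝ) with hm
  set h : ℂ → ℝ := fun ρ ↦ g ρ - liWindowWeight₀ n |ρ.im| with hh
  -- (1) the difference as one Finset sum
  have h1 : charLiPartialRe χ n T' - charWeightTrace χ n T' = ∑ ρ ∈ S, m ρ * h ρ := by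
    simp only [charLiPartialRe, charWeightTrace]
    rw [finsum_mem_eq_finite_toFinset_sum _ hfin, finsum_mem_eq_finite_toFinset_sum _ hfin, Complex.re_sum,
      ← Finset.sum_sub_distrib]
    refine Finset.sum_congr rfl fun ρ _ ↦ ?_
    simp only [hm, hh, hg, Complex.mul_re, Complex.natCast_re, Complex.natCast_im, zero_mul, sub_zero]
    ring
  -- (2) split at height `T`; the low part vanishes (on-line exactness)
  rw [h1, ← Finset.sum_filter_add_sum_filter_not S (fun ρ ↦ |ρ.im| ≤ T)]
  have hlow : ∑ ρ ∈ S.filter (fun ρ ↦ |ρ.im| ≤ T), m ρ * h ρ = 0 := by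
    refine Finset.sum_eq_zero fun ρ hρ ↦ ?_
    rw [Finset.mem_filter, hmemS, mem_lfunctionZeroBox] at hρ
    obtain ⟨⟨hz, h0, h1', -⟩, hle⟩ := hρ
    have hre : ρ.re = 1 / 2 := hRH ρ hz h0 h1' hle
    simp only [hh, hg, re_liTerm_onLine n hre, sub_self, mul_zero]
  rw [hlow, zero_add]
  set D := S.filter (fun ρ ↦ ¬ |ρ.im| ≤ T) with hD
  have hmemD : ∀ ρ, ρ ∈ D ↔ ρ ∈ lfunctionZeroBox χ T' ∧ T < |ρ.im| := fun ρ ↦ by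
    rw [hD, Finset.mem_filter, hmemS, not_le]
  -- (3) the inverse-moment tails are sums over `D`
  have htail : ∀ k : ℕ, charInvMomentTail χ k T T' = ∑ ρ ∈ D, m ρ / |ρ.im| ^ k := by
    intro k
    simp only [charInvMomentTail]
    rw [finsum_mem_eq_finite_toFinset_sum _ hfinD]
    refine Finset.sum_congr ?_ fun ρ _ ↦ rfl
    ext ρ
    rw [Set.Finite.mem_toFinset, Set.mem_sdiff, hmemD]
    constructor
    · rintro ⟨hB, hnot⟩
      refine ⟨hB, not_le.1 fun hle ↦ hnot ?_⟩
      obtain ⟨hz, h0, h1', -⟩ := mem_lfunctionZeroBox.1 hB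
      exact mem_lfunctionZeroBox.2 ⟨hz, h0, h1', hle⟩
    · rintro ⟨hB, hlt⟩
      exact ⟨hB, fun hmem ↦ (not_le.2 hlt) (mem_lfunctionZeroBox.1 hmem).2.2.2⟩
  -- (4) the reflection `ρ ↦ 1 − ρ̄` on `D`
  have hσmem : ∀ ρ ∈ D, 1 - conj ρ ∈ D := by
    intro ρ hρ
    obtain ⟨hB, hlt⟩ := (hmemD ρ).1 hρ
    refine (hmemD _).2 ⟨one_sub_conj_mem_box hχ hq hB, ?_⟩
    simpa using hlt
  have hσσ : ∀ ρ : ℂ, 1 - conj (1 - conj ρ) = ρ := fun ρ ↦ by simp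
  have hmσ : ∀ ρ ∈ D, m (1 - conj ρ) = m ρ := by
    intro ρ hρ
    obtain ⟨hB, -⟩ := (hmemD ρ).1 hρ
    obtain ⟨-, h0, h1', -⟩ := mem_lfunctionZeroBox.1 hB
    simp only [hm, WeilConverseChar.zeroOrder_one_sub_conj hχ hχ1 h0 h1']
  have hreindex : ∑ ρ ∈ D, m ρ * h (1 - conj ρ) = ∑ ρ ∈ D, m ρ * h ρ := by
    calc ∑ ρ ∈ D, m ρ * h (1 - conj ρ) = ∑ ρ ∈ D, m (1 - conj ρ) * h (1 - conj ρ) :=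
          Finset.sum_congr rfl fun ρ hρ ↦ by rw [hmσ ρ hρ]
      _ = ∑ ρ ∈ D, m ρ * h ρ :=
          Finset.sum_nbij' (fun ρ ↦ 1 - conj ρ) (fun ρ ↦ 1 - conj ρ) hσmem hσmem
            (fun ρ _ ↦ hσσ ρ) (fun ρ _ ↦ hσσ ρ) fun _ _ ↦ rfl
  have hhalf : ∑ ρ ∈ D, m ρ * h ρ = 1 / 2 * ∑ ρ ∈ D, m ρ * (h ρ + h (1 - conj ρ)) := by
    have e : ∑ ρ ∈ D, m ρ * (h ρ + h (1 - conj ρ)) = ∑ ρ ∈ D, m ρ * h ρ + ∑ ρ ∈ D, m ρ * h (1 - conj ρ) := by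
      rw [← Finset.sum_add_distrib]
      exact Finset.sum_congr rfl fun ρ _ ↦ by ring
    rw [e, hreindex]
    ring
  rw [hhalf]
  -- (5) termwise pair bound
  have hterm : ∀ ρ ∈ D, |m ρ * (h ρ + h (1 - conj ρ))| ≤
      2.82 * (n : ℝ) ^ 2 * (m ρ / |ρ.im| ^ 4) + (n : ℝ) / 2 * (m ρ / |ρ.im| ^ 3) := by
    intro ρ hρ
    obtain ⟨hB, hlt⟩ := (hmemD ρ).1 hρ
    obtain ⟨-, h0, h1', -⟩ := mem_lfunctionZeroBox.1 hB
    have h4 : 4 ≤ |ρ.im| := by linarith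
    have ha0 : 0 < |ρ.im| := by linarith
    have hn' : (n : ℝ) ≤ |ρ.im| ^ 2 / 4 := by nlinarith
    have hp := pair_two_sided_abs n h0 h1' h4 hn'
    have him1 : |(1 - conj ρ).im| = |ρ.im| := by simp
    have hsum : h ρ + h (1 - conj ρ) =
        (1 - (1 - 1 / ρ) ^ n).re + (1 - (1 - 1 / (1 - conj ρ)) ^ n).re - 2 * liWindowWeight n |ρ.im| := by
      simp only [hh, hg, him1]
      rw [liWindowWeight₀, if_neg ha0.ne']
      ring
    have hm0 : 0 ≤ m ρ := Nat.cast_nonneg _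
    rw [abs_mul, abs_of_nonneg hm0, hsum]
    have hmul := mul_le_mul_of_nonneg_left hp hm0
    have e : m ρ * (2.82 * (n : ℝ) ^ 2 / |ρ.im| ^ 4 + (n : ℝ) / (2 * |ρ.im| ^ 3)) =
        2.82 * (n : ℝ) ^ 2 * (m ρ / |ρ.im| ^ 4) + (n : ℝ) / 2 * (m ρ / |ρ.im| ^ 3) := by
      field_simp
    linarith
  -- (6) sum up: half the typed bound
  have hsum : |∑ ρ ∈ D, m ρ * (h ρ + h (1 - conj ρ))| ≤
      2.82 * (n : ℝ) ^ 2 * charInvMomentTail χ 4 T T' + (n : ℝ) / 2 * charInvMomentTail χ 3 T T' := by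
    rw [htail 4, htail 3, Finset.mul_sum, Finset.mul_sum, ← Finset.sum_add_distrib]
    exact (Finset.abs_sum_le_sum_abs _ _).trans (Finset.sum_le_sum hterm)
  have hnonneg : 0 ≤ 2.82 * (n : ℝ) ^ 2 * charInvMomentTail χ 4 T T' + (n : ℝ) / 2 * charInvMomentTail χ 3 T T' := by
    have h4 : 0 ≤ charInvMomentTail χ 4 T T' := by
      rw [htail 4]; exact Finset.sum_nonneg fun ρ _ ↦ by positivity
    have h3 : 0 ≤ charInvMomentTail χ 3 T T' := by
      rw [htail 3]; exact Finset.sum_nonneg fun ρ _ ↦ by positivity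
    positivity
  rw [abs_mul, abs_of_pos (by norm_num : (0 : ℝ) < 1 / 2)]
  linarith

/-- **Item `LiBoxTwoSidedChar` of route `LiDirichletAsymptotic`** (stmt-RiemannHypothesis-19629), closed BY NAME. -/
theorem liBoxTwoSidedChar_proof :
    Summit.RiemannHypothesis.RiemannHypothesis.Theses.LiDirichletAsymptotic.LiBoxTwoSidedChar :=
  fun q _ χ hχ hq n T T' hRH hT4 _ hn ↦ liBoxTwoSidedChar_bound q χ hχ hq n T T' hRH hT4 hn

end Summit.RiemannHypothesis.RiemannHypothesis.Theorems.LiTheory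

end
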